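/-
Copyright: the b2b-balaban T⁴-continuum CRUX team, row NE7b OWNER lineage `t4-ne7b-p1` (gen 136). Project licence.
-/
import Summits.QuantumFields.BalabanUV.T4Continuum.Spine.NE7b.SupNextHessianMatrix

/-!
# THE RESIDUAL FACTOR IS GLOBALLY REGULATED AT THE SMALL RATE `2λ_w + Λ_w` — (α4): (374)'s LOCATED OBSTRUCTION RESOLVED IN FORMAT.
# After extracting the constant, the linear part `⟨b_D,ζ⟩` and the quadratic part `½ζᵀK_Dζ` ((388)) from the next potential
# `W = −log Z` at the background `ψ₀`, the residual `r(ζ) = log Z(ψ₀+ζ) − log Z(ψ₀) + ⟨b_D,ζ⟩ + ½ζᵀK_Dζ` obeys, for EVERY `ζ` (no ball, no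
# smallness of the field),
#   `|r(ζ)| ≤ (λ_w + ½Λ_w)·Q(ζ)`,   hence   `e^{r(ζ)} ≤ e^{½(2λ_w + Λ_w)·Q(ζ)}`,   `Q(ζ) = Σ_Y ζ²`,
# by the two GLOBAL second-order letters of `W` ((316) upper, (318) lower — the two-sided second-order class) and the two Hessian letters
# ((320)): the stability RATE of the factor that re-enters the polymer road is the remainders' second-order class size `2λ_w + Λ_w` —
# REGENERATED from the current effective potential, NOT inherited as `κ₀(1+τ⁻¹)` and NOT doubled ((374)); on the ball it improves to the
# cubic letters of (386)∕(389) (row NE7b, node U5c; (313)∕(316)∕(318)∕(320)∕(388) BY NAME; [folklore])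

Cell `pub-balaban`, sub-cell `t4`, spine estimate NE7b (`T4WeightBudget.RelWeightBound`; the cell's OWN estimate — NOT PRINTED in
[Bałaban 1983–89], NOT PROVED).  Crux-route work under `Spine/NE7b/` by the row OWNER (`t4-ne7b-p1` gen 136, file (391)) under FREEZE
(0)'s crux-prover clause, on gen 135's SCOPING-d7 DECISION (d7′)(2′)(b) («the stability letter of `ĝ_D` with the rate regenerated, not
inherited»); NOTHING of Bałaban's is named as a Lean object, valued or asserted; no `T4Continuum/Support` leaf typed; no `def`, no notation
(`b_D`, `K_D`, `r` WRITTEN OUT); zero `sorry`.  Imports (BY NAME): the OWNER's (388) `…SupNextHessianMatrix` (`clm₁_apply_eq_dot`,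
`symmMatrix_form_eq`) and through it (320) (`hessian_neg_log_step_ge∕le`), (316) (`neg_log_step_upper_letter`), (318)
(`neg_log_step_lower_letter`), (313) (`hasFDerivAt_neg_log_step`), (297) (`cellSum_eq_sum_biUnion`).

WHAT IS PROVED ([folklore]; `Y = ⋃_{p∈C} cell p`, `Z(ψ) = ∫e^{−Σ_Y w_x(ω_x+ψ_x)}dN(0,M⁻¹)`):
* §1 `fderiv_neg_log_eq_bdot` (`D(−log Z)(ψ₀)[ζ] = ⟨b_D(ψ₀),ζ⟩`), `quadratic_part_two_sided` (`−2λ_wQ(ζ) ≤ ζᵀK_D(ψ₀)ζ ≤ Λ_wQ(ζ)`),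
  `first_order_two_sided` (`−½Λ_wQ(ζ) ≤ log Z(ψ₀+ζ) − log Z(ψ₀) + ⟨b_D,ζ⟩ ≤ λ_wQ(ζ)` — the global letters (316)∕(318) read with `b_D`);
* §2 THE END **`residual_global_letter`** (`|r(ζ)| ≤ (λ_w + ½Λ_w)·Q(ζ)` for EVERY `ζ`), **`residual_factor_regulated`**
  (`e^{r(ζ)} ≤ e^{½(2λ_w+Λ_w)Q(ζ)}` and `e^{−½(2λ_w+Λ_w)Q(ζ)} ≤ e^{r(ζ)}` for EVERY `ζ`); §3 toy.

HONEST (what this is NOT).  The rate `2λ_w + Λ_w` is the CURRENT remainders' second-order class size (hypotheses `hwlo`, `hwup`): that the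
NEXT remainders' class constants are again of that size after blocking∕rescaling — the CONTRACTION of the class — is NOT shown (the RG proper);
the global letter is quadratic, the on-ball cubic letter is (389); scalar skeleton ((A3), NC-NE7b-α UNRULED); nothing of Bałaban's
asserted.  BY-NAME EFFECT ON THE WALL: NONE.  NE7b NOT PRINTED ∕ NOT PROVED; spine PROVED 0∕9; rung (B)+1 — the programme's measures remain
FINITE-torus statements; NOT the mass gap, NOT Clay.  HONEST DEPENDENCY: continuum YM on T⁴ ⇐ BetaPertH ∧ nine spine estimates (0∕9 proved);
BetaPertH ⇐ (D1) ∧ (D4) ∧ CAP+tail; G-an2-4 gates asym, D1 and NE2∕3∕4.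
-/

set_option autoImplicit false
set_option maxSynthPendingDepth 2

noncomputable section

namespace Summit.QuantumFields.BalabanUV.T4Continuum.NE7b.SupResidualFactorRegulated

open MeasureTheory ProbabilityTheory Finset Real Matrix
open scoped BigOperators
open SupNextHessianMatrix (clm₁_apply_eq_dot symmMatrix_form_eq)
open SupEffectiveActionCovariance (hessian_neg_log_step_ge hessian_neg_log_step_le)
open SupEffectiveActionUpperLetter (neg_log_step_upper_letter)
open SupEffectiveActionLowerLetter (neg_log_step_lower_letter)
open SupEffectiveActionDerivative (hasFDerivAt_neg_log_step)
open SupSmallFieldGasReal (cellSum_eq_sum_biUnion)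

variable {ι : Type} [Fintype ι] [DecidableEq ι] {V : Type*}

section Road

variable {cell : V → Finset ι} {w w' w'' : ι → ℝ → ℝ} {κ₀ κ₁ κ₂ τ δ θ : ℝ}

/-! ## §1. The three ingredients read with `b_D` and `K_D` -/

/-- **`D(−log Z)(ψ₀)[ζ] = ⟨b_D(ψ₀), ζ⟩`** (the Fréchet derivative of (313), on the `Y`-form of `Z`). [folklore] -/
theorem fderiv_neg_log_eq_bdot {M : Matrix ι ι ℝ} {γop : ℝ} (hM : M.PosDef) (hΓop : (γop • (1 : Matrix ι ι ℝ) - M⁻¹).PosSemidef)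
    (hdisj : ∀ p q, p ≠ q → Disjoint (cell p) (cell q)) (hw' : ∀ x t, HasDerivAt (w x) (w' x t) t) (hw'm : ∀ x, Measurable (w' x))
    (hκ₀ : 0 ≤ κ₀) (hκ₁ : 0 ≤ κ₁) (hτ : 0 < τ) (hδ : 0 < δ) (hθ0 : 0 < θ) (hθ1 : θ < 1)
    (hκθ : (2 * κ₀ * (1 + τ) + 4 * δ) * γop ≤ θ) (hstab : ∀ x, ∀ t : ℝ, -(κ₀ * t ^ 2) ≤ w x t)
    (hw'b : ∀ x t, |w' x t| ≤ κ₁ * |t|) (C : Finset V) (ψ₀ ζ : EuclideanSpace ℝ ι) :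
    fderiv ℝ (fun φ : EuclideanSpace ℝ ι =>
        -Real.log (∫ ω : EuclideanSpace ℝ ι, exp (-(∑ x ∈ C.biUnion cell, w x (ω x + φ x))) ∂(multivariateGaussian 0 M⁻¹))) ψ₀ ζ =
      ((fun x : ι => ((∫ ω : EuclideanSpace ℝ ι, exp (-(∑ p ∈ C, ∑ x ∈ cell p, w x (ω x + ψ₀ x))) ∂(multivariateGaussian 0 M⁻¹))⁻¹ •
        ∫ ω : EuclideanSpace ℝ ι, exp (-(∑ p ∈ C, ∑ x ∈ cell p, w x (ω x + ψ₀ x))) •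
          (∑ p ∈ C, ∑ x ∈ cell p, (w' x (ω x + ψ₀ x)) • (EuclideanSpace.proj x : EuclideanSpace ℝ ι →L[ℝ] ℝ))
          ∂(multivariateGaussian 0 M⁻¹)) (EuclideanSpace.single x (1 : ℝ))) ⬝ᵥ (WithLp.ofLp ζ)) := by
  have hd := hasFDerivAt_neg_log_step hM.inv.posSemidef hΓop hdisj hw' hw'm hκ₀ hκ₁ hτ hδ hθ0 hθ1 hκθ hstab hw'b C ψ₀
  have hfun : (fun φ : EuclideanSpace ℝ ι =>
      -Real.log (∫ ω : EuclideanSpace ℝ ι, exp (-(∑ p ∈ C, ∑ x ∈ cell p, w x (ω x + φ x))) ∂(multivariateGaussian 0 M⁻¹))) =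
      (fun φ : EuclideanSpace ℝ ι =>
        -Real.log (∫ ω : EuclideanSpace ℝ ι, exp (-(∑ x ∈ C.biUnion cell, w x (ω x + φ x))) ∂(multivariateGaussian 0 M⁻¹))) := by
    funext φ
    simp only [cellSum_eq_sum_biUnion cell hdisj C]
  rw [← hfun, hd.fderiv]
  exact clm₁_apply_eq_dot _ ζ

/-- **The quadratic part is two-sided**: `−2λ_w·Q(ζ) ≤ ζᵀK_D(ψ₀)ζ ≤ Λ_w·Q(ζ)`, `Q(ζ) = Σ_Y ζ²` ((320)'s Hessian letters via (388)). [folklore] -/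
theorem quadratic_part_two_sided {M : Matrix ι ι ℝ} {γop m lamw Λw : ℝ} (hM : M.PosDef)
    (hfl : ∀ z : ι → ℝ, m * ∑ i, z i ^ 2 ≤ z ⬝ᵥ (M *ᵥ z)) (hΓop : (γop • (1 : Matrix ι ι ℝ) - M⁻¹).PosSemidef)
    (hdisj : ∀ p q, p ≠ q → Disjoint (cell p) (cell q)) (hw' : ∀ x t, HasDerivAt (w x) (w' x t) t)
    (hw'' : ∀ x t, HasDerivAt (w' x) (w'' x t) t) (hw'm : ∀ x, Measurable (w' x)) (hw''m : ∀ x, Measurable (w'' x))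
    (hκ₀ : 0 ≤ κ₀) (hκ₁ : 0 ≤ κ₁) (hτ : 0 < τ) (hδ : 0 < δ) (hθ0 : 0 < θ) (hθ1 : θ < 1) (hκθ : (2 * κ₀ * (1 + τ) + 4 * δ) * γop ≤ θ)
    (hκθ₆ : 6 * κ₀ * (1 + τ) * γop ≤ θ) (hstab : ∀ x, ∀ t : ℝ, -(κ₀ * t ^ 2) ≤ w x t) (hquad : ∀ x, ∀ t : ℝ, w x t ≤ κ₀ * t ^ 2)
    (hw'b : ∀ x t, |w' x t| ≤ κ₁ * |t|) (hw''b : ∀ x t, |w'' x t| ≤ κ₂) (hlamw : 0 ≤ lamw)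
    (hwlo : ∀ u (a b : ℝ), w u a + w' u a * (b - a) - lamw / 2 * (b - a) ^ 2 ≤ w u b)
    (hwup : ∀ x (a b : ℝ), w x b ≤ w x a + w' x a * (b - a) + Λw / 2 * (b - a) ^ 2) (hm : 2 * lamw ≤ m) (C : Finset V)
    (ψ₀ ζ : EuclideanSpace ℝ ι) :
    -(2 * lamw * (∑ x ∈ C.biUnion cell, ζ x ^ 2)) ≤ ((WithLp.ofLp ζ) ⬝ᵥ (Matrix.of fun x y : ι =>
      ((((∫ ω : EuclideanSpace ℝ ι, exp (-(∑ p ∈ C, ∑ x ∈ cell p, w x (ω x + ψ₀ x))) ∂(multivariateGaussian 0 M⁻¹))⁻¹ •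
          (∫ ω : EuclideanSpace ℝ ι, exp (-(∑ p ∈ C, ∑ x ∈ cell p, w x (ω x + ψ₀ x))) •
            ((∑ p ∈ C, ∑ x ∈ cell p, (w'' x (ω x + ψ₀ x)) • ((EuclideanSpace.proj x : EuclideanSpace ℝ ι →L[ℝ] ℝ).smulRight
                (EuclideanSpace.proj x : EuclideanSpace ℝ ι →L[ℝ] ℝ))) -
              (∑ p ∈ C, ∑ x ∈ cell p, (w' x (ω x + ψ₀ x)) • (EuclideanSpace.proj x : EuclideanSpace ℝ ι →L[ℝ] ℝ)).smulRight
                (∑ p ∈ C, ∑ x ∈ cell p, (w' x (ω x + ψ₀ x)) • (EuclideanSpace.proj x : EuclideanSpace ℝ ι →L[ℝ] ℝ)))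
            ∂(multivariateGaussian 0 M⁻¹)) +
        (((∫ ω : EuclideanSpace ℝ ι, exp (-(∑ p ∈ C, ∑ x ∈ cell p, w x (ω x + ψ₀ x))) ∂(multivariateGaussian 0 M⁻¹)) ^ 2)⁻¹ •
          ∫ ω : EuclideanSpace ℝ ι, exp (-(∑ p ∈ C, ∑ x ∈ cell p, w x (ω x + ψ₀ x))) •
            (∑ p ∈ C, ∑ x ∈ cell p, (w' x (ω x + ψ₀ x)) • (EuclideanSpace.proj x : EuclideanSpace ℝ ι →L[ℝ] ℝ))
            ∂(multivariateGaussian 0 M⁻¹)).smulRight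
          (∫ ω : EuclideanSpace ℝ ι, exp (-(∑ p ∈ C, ∑ x ∈ cell p, w x (ω x + ψ₀ x))) •
            (∑ p ∈ C, ∑ x ∈ cell p, (w' x (ω x + ψ₀ x)) • (EuclideanSpace.proj x : EuclideanSpace ℝ ι →L[ℝ] ℝ))
            ∂(multivariateGaussian 0 M⁻¹)))
          (EuclideanSpace.single x (1 : ℝ)) (EuclideanSpace.single y (1 : ℝ)) +
        ((∫ ω : EuclideanSpace ℝ ι, exp (-(∑ p ∈ C, ∑ x ∈ cell p, w x (ω x + ψ₀ x))) ∂(multivariateGaussian 0 M⁻¹))⁻¹ •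
          (∫ ω : EuclideanSpace ℝ ι, exp (-(∑ p ∈ C, ∑ x ∈ cell p, w x (ω x + ψ₀ x))) •
            ((∑ p ∈ C, ∑ x ∈ cell p, (w'' x (ω x + ψ₀ x)) • ((EuclideanSpace.proj x : EuclideanSpace ℝ ι →L[ℝ] ℝ).smulRight
                (EuclideanSpace.proj x : EuclideanSpace ℝ ι →L[ℝ] ℝ))) -
              (∑ p ∈ C, ∑ x ∈ cell p, (w' x (ω x + ψ₀ x)) • (EuclideanSpace.proj x : EuclideanSpace ℝ ι →L[ℝ] ℝ)).smulRight
                (∑ p ∈ C, ∑ x ∈ cell p, (w' x (ω x + ψ₀ x)) • (EuclideanSpace.proj x : EuclideanSpace ℝ ι →L[ℝ] ℝ)))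
            ∂(multivariateGaussian 0 M⁻¹)) +
        (((∫ ω : EuclideanSpace ℝ ι, exp (-(∑ p ∈ C, ∑ x ∈ cell p, w x (ω x + ψ₀ x))) ∂(multivariateGaussian 0 M⁻¹)) ^ 2)⁻¹ •
          ∫ ω : EuclideanSpace ℝ ι, exp (-(∑ p ∈ C, ∑ x ∈ cell p, w x (ω x + ψ₀ x))) •
            (∑ p ∈ C, ∑ x ∈ cell p, (w' x (ω x + ψ₀ x)) • (EuclideanSpace.proj x : EuclideanSpace ℝ ι →L[ℝ] ℝ))
            ∂(multivariateGaussian 0 M⁻¹)).smulRight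
          (∫ ω : EuclideanSpace ℝ ι, exp (-(∑ p ∈ C, ∑ x ∈ cell p, w x (ω x + ψ₀ x))) •
            (∑ p ∈ C, ∑ x ∈ cell p, (w' x (ω x + ψ₀ x)) • (EuclideanSpace.proj x : EuclideanSpace ℝ ι →L[ℝ] ℝ))
            ∂(multivariateGaussian 0 M⁻¹)))
          (EuclideanSpace.single y (1 : ℝ)) (EuclideanSpace.single x (1 : ℝ))) / 2)) *ᵥ (WithLp.ofLp ζ)) ∧
      ((WithLp.ofLp ζ) ⬝ᵥ (Matrix.of fun x y : ι =>
      ((((∫ ω : EuclideanSpace ℝ ι, exp (-(∑ p ∈ C, ∑ x ∈ cell p, w x (ω x + ψ₀ x))) ∂(multivariateGaussian 0 M⁻¹))⁻¹ •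
          (∫ ω : EuclideanSpace ℝ ι, exp (-(∑ p ∈ C, ∑ x ∈ cell p, w x (ω x + ψ₀ x))) •
            ((∑ p ∈ C, ∑ x ∈ cell p, (w'' x (ω x + ψ₀ x)) • ((EuclideanSpace.proj x : EuclideanSpace ℝ ι →L[ℝ] ℝ).smulRight
                (EuclideanSpace.proj x : EuclideanSpace ℝ ι →L[ℝ] ℝ))) -
              (∑ p ∈ C, ∑ x ∈ cell p, (w' x (ω x + ψ₀ x)) • (EuclideanSpace.proj x : EuclideanSpace ℝ ι →L[ℝ] ℝ)).smulRight
                (∑ p ∈ C, ∑ x ∈ cell p, (w' x (ω x + ψ₀ x)) • (EuclideanSpace.proj x : EuclideanSpace ℝ ι →L[ℝ] ℝ)))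
            ∂(multivariateGaussian 0 M⁻¹)) +
        (((∫ ω : EuclideanSpace ℝ ι, exp (-(∑ p ∈ C, ∑ x ∈ cell p, w x (ω x + ψ₀ x))) ∂(multivariateGaussian 0 M⁻¹)) ^ 2)⁻¹ •
          ∫ ω : EuclideanSpace ℝ ι, exp (-(∑ p ∈ C, ∑ x ∈ cell p, w x (ω x + ψ₀ x))) •
            (∑ p ∈ C, ∑ x ∈ cell p, (w' x (ω x + ψ₀ x)) • (EuclideanSpace.proj x : EuclideanSpace ℝ ι →L[ℝ] ℝ))
            ∂(multivariateGaussian 0 M⁻¹)).smulRight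
          (∫ ω : EuclideanSpace ℝ ι, exp (-(∑ p ∈ C, ∑ x ∈ cell p, w x (ω x + ψ₀ x))) •
            (∑ p ∈ C, ∑ x ∈ cell p, (w' x (ω x + ψ₀ x)) • (EuclideanSpace.proj x : EuclideanSpace ℝ ι →L[ℝ] ℝ))
            ∂(multivariateGaussian 0 M⁻¹)))
          (EuclideanSpace.single x (1 : ℝ)) (EuclideanSpace.single y (1 : ℝ)) +
        ((∫ ω : EuclideanSpace ℝ ι, exp (-(∑ p ∈ C, ∑ x ∈ cell p, w x (ω x + ψ₀ x))) ∂(multivariateGaussian 0 M⁻¹))⁻¹ •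
          (∫ ω : EuclideanSpace ℝ ι, exp (-(∑ p ∈ C, ∑ x ∈ cell p, w x (ω x + ψ₀ x))) •
            ((∑ p ∈ C, ∑ x ∈ cell p, (w'' x (ω x + ψ₀ x)) • ((EuclideanSpace.proj x : EuclideanSpace ℝ ι →L[ℝ] ℝ).smulRight
                (EuclideanSpace.proj x : EuclideanSpace ℝ ι →L[ℝ] ℝ))) -
              (∑ p ∈ C, ∑ x ∈ cell p, (w' x (ω x + ψ₀ x)) • (EuclideanSpace.proj x : EuclideanSpace ℝ ι →L[ℝ] ℝ)).smulRight
                (∑ p ∈ C, ∑ x ∈ cell p, (w' x (ω x + ψ₀ x)) • (EuclideanSpace.proj x : EuclideanSpace ℝ ι →L[ℝ] ℝ)))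
            ∂(multivariateGaussian 0 M⁻¹)) +
        (((∫ ω : EuclideanSpace ℝ ι, exp (-(∑ p ∈ C, ∑ x ∈ cell p, w x (ω x + ψ₀ x))) ∂(multivariateGaussian 0 M⁻¹)) ^ 2)⁻¹ •
          ∫ ω : EuclideanSpace ℝ ι, exp (-(∑ p ∈ C, ∑ x ∈ cell p, w x (ω x + ψ₀ x))) •
            (∑ p ∈ C, ∑ x ∈ cell p, (w' x (ω x + ψ₀ x)) • (EuclideanSpace.proj x : EuclideanSpace ℝ ι →L[ℝ] ℝ))
            ∂(multivariateGaussian 0 M⁻¹)).smulRight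
          (∫ ω : EuclideanSpace ℝ ι, exp (-(∑ p ∈ C, ∑ x ∈ cell p, w x (ω x + ψ₀ x))) •
            (∑ p ∈ C, ∑ x ∈ cell p, (w' x (ω x + ψ₀ x)) • (EuclideanSpace.proj x : EuclideanSpace ℝ ι →L[ℝ] ℝ))
            ∂(multivariateGaussian 0 M⁻¹)))
          (EuclideanSpace.single y (1 : ℝ)) (EuclideanSpace.single x (1 : ℝ))) / 2)) *ᵥ (WithLp.ofLp ζ)) ≤ Λw * (∑ x ∈ C.biUnion cell, ζ x ^ 2) := by
  have hΓ : (M⁻¹).PosSemidef := hM.inv.posSemidef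
  set L : EuclideanSpace ℝ ι →L[ℝ] EuclideanSpace ℝ ι →L[ℝ] ℝ :=
    ((∫ ω : EuclideanSpace ℝ ι, exp (-(∑ p ∈ C, ∑ x ∈ cell p, w x (ω x + ψ₀ x))) ∂(multivariateGaussian 0 M⁻¹))⁻¹ •
          (∫ ω : EuclideanSpace ℝ ι, exp (-(∑ p ∈ C, ∑ x ∈ cell p, w x (ω x + ψ₀ x))) •
            ((∑ p ∈ C, ∑ x ∈ cell p, (w'' x (ω x + ψ₀ x)) • ((EuclideanSpace.proj x : EuclideanSpace ℝ ι →L[ℝ] ℝ).smulRight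
                (EuclideanSpace.proj x : EuclideanSpace ℝ ι →L[ℝ] ℝ))) -
              (∑ p ∈ C, ∑ x ∈ cell p, (w' x (ω x + ψ₀ x)) • (EuclideanSpace.proj x : EuclideanSpace ℝ ι →L[ℝ] ℝ)).smulRight
                (∑ p ∈ C, ∑ x ∈ cell p, (w' x (ω x + ψ₀ x)) • (EuclideanSpace.proj x : EuclideanSpace ℝ ι →L[ℝ] ℝ)))
            ∂(multivariateGaussian 0 M⁻¹)) +
        (((∫ ω : EuclideanSpace ℝ ι, exp (-(∑ p ∈ C, ∑ x ∈ cell p, w x (ω x + ψ₀ x))) ∂(multivariateGaussian 0 M⁻¹)) ^ 2)⁻¹ •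
          ∫ ω : EuclideanSpace ℝ ι, exp (-(∑ p ∈ C, ∑ x ∈ cell p, w x (ω x + ψ₀ x))) •
            (∑ p ∈ C, ∑ x ∈ cell p, (w' x (ω x + ψ₀ x)) • (EuclideanSpace.proj x : EuclideanSpace ℝ ι →L[ℝ] ℝ))
            ∂(multivariateGaussian 0 M⁻¹)).smulRight
          (∫ ω : EuclideanSpace ℝ ι, exp (-(∑ p ∈ C, ∑ x ∈ cell p, w x (ω x + ψ₀ x))) •
            (∑ p ∈ C, ∑ x ∈ cell p, (w' x (ω x + ψ₀ x)) • (EuclideanSpace.proj x : EuclideanSpace ℝ ι →L[ℝ] ℝ))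
            ∂(multivariateGaussian 0 M⁻¹))) with hL
  rw [symmMatrix_form_eq L ζ, hL, ← cellSum_eq_sum_biUnion cell hdisj C (fun x => ζ x ^ 2)]
  exact ⟨hessian_neg_log_step_ge hM hfl hΓop hdisj hw' hw'' hw'm hw''m hκ₀ hκ₁ hτ hδ hθ0 hθ1 hκθ hstab hw'b hw''b hlamw hwlo hm C ψ₀ ζ,
    hessian_neg_log_step_le hΓ hΓop hdisj hw' hw'' hw'm hw''m hκ₀ hκ₁ hτ hδ hθ0 hθ1 hκθ hκθ₆ hstab hquad hw'b hw''b hwup C ψ₀ ζ⟩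

/-- **The first-order remainder is two-sided, GLOBALLY**: for every `ζ`,
`−½Λ_w·Q(ζ) ≤ log Z(ψ₀+ζ) − log Z(ψ₀) + ⟨b_D(ψ₀),ζ⟩ ≤ λ_w·Q(ζ)` ((316) gives the lower, (318) the upper bound). [folklore] -/
theorem first_order_two_sided {M : Matrix ι ι ℝ} {γop m lamw Λw : ℝ} (hM : M.PosDef)
    (hfl : ∀ z : ι → ℝ, m * ∑ i, z i ^ 2 ≤ z ⬝ᵥ (M *ᵥ z)) (hΓop : (γop • (1 : Matrix ι ι ℝ) - M⁻¹).PosSemidef)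
    (hdisj : ∀ p q, p ≠ q → Disjoint (cell p) (cell q)) (hw' : ∀ x t, HasDerivAt (w x) (w' x t) t) (hw'm : ∀ x, Measurable (w' x))
    (hκ₀ : 0 ≤ κ₀) (hκ₁ : 0 ≤ κ₁) (hτ : 0 < τ) (hδ : 0 < δ) (hθ0 : 0 < θ) (hθ1 : θ < 1) (hκθ : (2 * κ₀ * (1 + τ) + 4 * δ) * γop ≤ θ)
    (hκθ₆ : 6 * κ₀ * (1 + τ) * γop ≤ θ) (hstab : ∀ x, ∀ t : ℝ, -(κ₀ * t ^ 2) ≤ w x t) (hquad : ∀ x, ∀ t : ℝ, w x t ≤ κ₀ * t ^ 2)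
    (hw'b : ∀ x t, |w' x t| ≤ κ₁ * |t|) (hlamw : 0 ≤ lamw)
    (hwlo : ∀ u (a b : ℝ), w u a + w' u a * (b - a) - lamw / 2 * (b - a) ^ 2 ≤ w u b)
    (hwup : ∀ x (a b : ℝ), w x b ≤ w x a + w' x a * (b - a) + Λw / 2 * (b - a) ^ 2) (hm : 2 * lamw ≤ m) (C : Finset V)
    (ψ₀ ζ : EuclideanSpace ℝ ι) :
    -(Λw / 2 * (∑ x ∈ C.biUnion cell, ζ x ^ 2)) ≤
        Real.log (∫ ω : EuclideanSpace ℝ ι, exp (-(∑ x ∈ C.biUnion cell, w x (ω x + (ψ₀ x + ζ x)))) ∂(multivariateGaussian 0 M⁻¹)) -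
            Real.log (∫ ω : EuclideanSpace ℝ ι, exp (-(∑ x ∈ C.biUnion cell, w x (ω x + ψ₀ x))) ∂(multivariateGaussian 0 M⁻¹)) +
          ((fun x : ι => ((∫ ω : EuclideanSpace ℝ ι, exp (-(∑ p ∈ C, ∑ x ∈ cell p, w x (ω x + ψ₀ x))) ∂(multivariateGaussian 0 M⁻¹))⁻¹ •
        ∫ ω : EuclideanSpace ℝ ι, exp (-(∑ p ∈ C, ∑ x ∈ cell p, w x (ω x + ψ₀ x))) •
          (∑ p ∈ C, ∑ x ∈ cell p, (w' x (ω x + ψ₀ x)) • (EuclideanSpace.proj x : EuclideanSpace ℝ ι →L[ℝ] ℝ))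
          ∂(multivariateGaussian 0 M⁻¹)) (EuclideanSpace.single x (1 : ℝ))) ⬝ᵥ (WithLp.ofLp ζ)) ∧
      Real.log (∫ ω : EuclideanSpace ℝ ι, exp (-(∑ x ∈ C.biUnion cell, w x (ω x + (ψ₀ x + ζ x)))) ∂(multivariateGaussian 0 M⁻¹)) -
            Real.log (∫ ω : EuclideanSpace ℝ ι, exp (-(∑ x ∈ C.biUnion cell, w x (ω x + ψ₀ x))) ∂(multivariateGaussian 0 M⁻¹)) +
          ((fun x : ι => ((∫ ω : EuclideanSpace ℝ ι, exp (-(∑ p ∈ C, ∑ x ∈ cell p, w x (ω x + ψ₀ x))) ∂(multivariateGaussian 0 M⁻¹))⁻¹ •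
        ∫ ω : EuclideanSpace ℝ ι, exp (-(∑ p ∈ C, ∑ x ∈ cell p, w x (ω x + ψ₀ x))) •
          (∑ p ∈ C, ∑ x ∈ cell p, (w' x (ω x + ψ₀ x)) • (EuclideanSpace.proj x : EuclideanSpace ℝ ι →L[ℝ] ℝ))
          ∂(multivariateGaussian 0 M⁻¹)) (EuclideanSpace.single x (1 : ℝ))) ⬝ᵥ (WithLp.ofLp ζ)) ≤
        lamw * (∑ x ∈ C.biUnion cell, ζ x ^ 2) := by
  have hΓ : (M⁻¹).PosSemidef := hM.inv.posSemidef
  have hup := neg_log_step_upper_letter hΓ hΓop hdisj hw' hw'm hκ₀ hκ₁ hτ hδ hθ0 hθ1 hκθ hκθ₆ hstab hquad hw'b hwup C ψ₀ (ψ₀ + ζ)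
  have hlo := neg_log_step_lower_letter hM hfl hΓop hdisj hw' hw'm hκ₀ hκ₁ hτ hδ hθ0 hθ1 hκθ hstab hw'b hlamw hwlo hm C ψ₀ (ψ₀ + ζ)
  have hb := fderiv_neg_log_eq_bdot hM hΓop hdisj hw' hw'm hκ₀ hκ₁ hτ hδ hθ0 hθ1 hκθ hstab hw'b C ψ₀ ζ
  simp only [cellSum_eq_sum_biUnion cell hdisj C, WithLp.ofLp_add, Pi.add_apply, add_sub_cancel_left] at hup hlo
  rw [hb] at hup hlo
  constructor
  · linarith
  · linarith

/-! ## §2. THE END: the residual's global letter and the regulated residual factor -/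

/-- **THE RESIDUAL'S GLOBAL LETTER**: for EVERY `ζ`, `|r(ζ)| ≤ (λ_w + ½Λ_w)·Q(ζ)` with
`r(ζ) = log Z(ψ₀+ζ) − log Z(ψ₀) + ⟨b_D(ψ₀),ζ⟩ + ½ζᵀK_D(ψ₀)ζ`. [folklore] -/
theorem residual_global_letter {M : Matrix ι ι ℝ} {γop m lamw Λw : ℝ} (hM : M.PosDef)
    (hfl : ∀ z : ι → ℝ, m * ∑ i, z i ^ 2 ≤ z ⬝ᵥ (M *ᵥ z)) (hΓop : (γop • (1 : Matrix ι ι ℝ) - M⁻¹).PosSemidef)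
    (hdisj : ∀ p q, p ≠ q → Disjoint (cell p) (cell q)) (hw' : ∀ x t, HasDerivAt (w x) (w' x t) t)
    (hw'' : ∀ x t, HasDerivAt (w' x) (w'' x t) t) (hw'm : ∀ x, Measurable (w' x)) (hw''m : ∀ x, Measurable (w'' x))
    (hκ₀ : 0 ≤ κ₀) (hκ₁ : 0 ≤ κ₁) (hτ : 0 < τ) (hδ : 0 < δ) (hθ0 : 0 < θ) (hθ1 : θ < 1) (hκθ : (2 * κ₀ * (1 + τ) + 4 * δ) * γop ≤ θ)
    (hκθ₆ : 6 * κ₀ * (1 + τ) * γop ≤ θ) (hstab : ∀ x, ∀ t : ℝ, -(κ₀ * t ^ 2) ≤ w x t) (hquad : ∀ x, ∀ t : ℝ, w x t ≤ κ₀ * t ^ 2)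
    (hw'b : ∀ x t, |w' x t| ≤ κ₁ * |t|) (hw''b : ∀ x t, |w'' x t| ≤ κ₂) (hlamw : 0 ≤ lamw)
    (hwlo : ∀ u (a b : ℝ), w u a + w' u a * (b - a) - lamw / 2 * (b - a) ^ 2 ≤ w u b)
    (hwup : ∀ x (a b : ℝ), w x b ≤ w x a + w' x a * (b - a) + Λw / 2 * (b - a) ^ 2) (hm : 2 * lamw ≤ m) (C : Finset V)
    (ψ₀ ζ : EuclideanSpace ℝ ι) :
    |(Real.log (∫ ω : EuclideanSpace ℝ ι, exp (-(∑ x ∈ C.biUnion cell, w x (ω x + (ψ₀ x + ζ x)))) ∂(multivariateGaussian 0 M⁻¹)) -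
          Real.log (∫ ω : EuclideanSpace ℝ ι, exp (-(∑ x ∈ C.biUnion cell, w x (ω x + ψ₀ x))) ∂(multivariateGaussian 0 M⁻¹)) +
        ((fun x : ι => ((∫ ω : EuclideanSpace ℝ ι, exp (-(∑ p ∈ C, ∑ x ∈ cell p, w x (ω x + ψ₀ x))) ∂(multivariateGaussian 0 M⁻¹))⁻¹ •
        ∫ ω : EuclideanSpace ℝ ι, exp (-(∑ p ∈ C, ∑ x ∈ cell p, w x (ω x + ψ₀ x))) •
          (∑ p ∈ C, ∑ x ∈ cell p, (w' x (ω x + ψ₀ x)) • (EuclideanSpace.proj x : EuclideanSpace ℝ ι →L[ℝ] ℝ))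
          ∂(multivariateGaussian 0 M⁻¹)) (EuclideanSpace.single x (1 : ℝ))) ⬝ᵥ (WithLp.ofLp ζ)) +
        ((WithLp.ofLp ζ) ⬝ᵥ (Matrix.of fun x y : ι =>
      ((((∫ ω : EuclideanSpace ℝ ι, exp (-(∑ p ∈ C, ∑ x ∈ cell p, w x (ω x + ψ₀ x))) ∂(multivariateGaussian 0 M⁻¹))⁻¹ •
          (∫ ω : EuclideanSpace ℝ ι, exp (-(∑ p ∈ C, ∑ x ∈ cell p, w x (ω x + ψ₀ x))) •
            ((∑ p ∈ C, ∑ x ∈ cell p, (w'' x (ω x + ψ₀ x)) • ((EuclideanSpace.proj x : EuclideanSpace ℝ ι →L[ℝ] ℝ).smulRight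
                (EuclideanSpace.proj x : EuclideanSpace ℝ ι →L[ℝ] ℝ))) -
              (∑ p ∈ C, ∑ x ∈ cell p, (w' x (ω x + ψ₀ x)) • (EuclideanSpace.proj x : EuclideanSpace ℝ ι →L[ℝ] ℝ)).smulRight
                (∑ p ∈ C, ∑ x ∈ cell p, (w' x (ω x + ψ₀ x)) • (EuclideanSpace.proj x : EuclideanSpace ℝ ι →L[ℝ] ℝ)))
            ∂(multivariateGaussian 0 M⁻¹)) +
        (((∫ ω : EuclideanSpace ℝ ι, exp (-(∑ p ∈ C, ∑ x ∈ cell p, w x (ω x + ψ₀ x))) ∂(multivariateGaussian 0 M⁻¹)) ^ 2)⁻¹ •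
          ∫ ω : EuclideanSpace ℝ ι, exp (-(∑ p ∈ C, ∑ x ∈ cell p, w x (ω x + ψ₀ x))) •
            (∑ p ∈ C, ∑ x ∈ cell p, (w' x (ω x + ψ₀ x)) • (EuclideanSpace.proj x : EuclideanSpace ℝ ι →L[ℝ] ℝ))
            ∂(multivariateGaussian 0 M⁻¹)).smulRight
          (∫ ω : EuclideanSpace ℝ ι, exp (-(∑ p ∈ C, ∑ x ∈ cell p, w x (ω x + ψ₀ x))) •
            (∑ p ∈ C, ∑ x ∈ cell p, (w' x (ω x + ψ₀ x)) • (EuclideanSpace.proj x : EuclideanSpace ℝ ι →L[ℝ] ℝ))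
            ∂(multivariateGaussian 0 M⁻¹)))
          (EuclideanSpace.single x (1 : ℝ)) (EuclideanSpace.single y (1 : ℝ)) +
        ((∫ ω : EuclideanSpace ℝ ι, exp (-(∑ p ∈ C, ∑ x ∈ cell p, w x (ω x + ψ₀ x))) ∂(multivariateGaussian 0 M⁻¹))⁻¹ •
          (∫ ω : EuclideanSpace ℝ ι, exp (-(∑ p ∈ C, ∑ x ∈ cell p, w x (ω x + ψ₀ x))) •
            ((∑ p ∈ C, ∑ x ∈ cell p, (w'' x (ω x + ψ₀ x)) • ((EuclideanSpace.proj x : EuclideanSpace ℝ ι →L[ℝ] ℝ).smulRight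
                (EuclideanSpace.proj x : EuclideanSpace ℝ ι →L[ℝ] ℝ))) -
              (∑ p ∈ C, ∑ x ∈ cell p, (w' x (ω x + ψ₀ x)) • (EuclideanSpace.proj x : EuclideanSpace ℝ ι →L[ℝ] ℝ)).smulRight
                (∑ p ∈ C, ∑ x ∈ cell p, (w' x (ω x + ψ₀ x)) • (EuclideanSpace.proj x : EuclideanSpace ℝ ι →L[ℝ] ℝ)))
            ∂(multivariateGaussian 0 M⁻¹)) +
        (((∫ ω : EuclideanSpace ℝ ι, exp (-(∑ p ∈ C, ∑ x ∈ cell p, w x (ω x + ψ₀ x))) ∂(multivariateGaussian 0 M⁻¹)) ^ 2)⁻¹ •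
          ∫ ω : EuclideanSpace ℝ ι, exp (-(∑ p ∈ C, ∑ x ∈ cell p, w x (ω x + ψ₀ x))) •
            (∑ p ∈ C, ∑ x ∈ cell p, (w' x (ω x + ψ₀ x)) • (EuclideanSpace.proj x : EuclideanSpace ℝ ι →L[ℝ] ℝ))
            ∂(multivariateGaussian 0 M⁻¹)).smulRight
          (∫ ω : EuclideanSpace ℝ ι, exp (-(∑ p ∈ C, ∑ x ∈ cell p, w x (ω x + ψ₀ x))) •
            (∑ p ∈ C, ∑ x ∈ cell p, (w' x (ω x + ψ₀ x)) • (EuclideanSpace.proj x : EuclideanSpace ℝ ι →L[ℝ] ℝ))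
            ∂(multivariateGaussian 0 M⁻¹)))
          (EuclideanSpace.single y (1 : ℝ)) (EuclideanSpace.single x (1 : ℝ))) / 2)) *ᵥ (WithLp.ofLp ζ)) / 2)| ≤
      (lamw + Λw / 2) * (∑ x ∈ C.biUnion cell, ζ x ^ 2) := by
  obtain ⟨q1, q2⟩ := quadratic_part_two_sided hM hfl hΓop hdisj hw' hw'' hw'm hw''m hκ₀ hκ₁ hτ hδ hθ0 hθ1 hκθ hκθ₆ hstab hquad hw'b hw''b
    hlamw hwlo hwup hm C ψ₀ ζ
  obtain ⟨f1, f2⟩ := first_order_two_sided hM hfl hΓop hdisj hw' hw'm hκ₀ hκ₁ hτ hδ hθ0 hθ1 hκθ hκθ₆ hstab hquad hw'b hlamw hwlo hwup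
    hm C ψ₀ ζ
  rw [abs_le]
  constructor
  · linarith
  · linarith

/-- **THE RESIDUAL FACTOR IS GLOBALLY REGULATED AT THE SMALL RATE `2λ_w + Λ_w`**: for EVERY `ζ`,
`e^{−½(2λ_w+Λ_w)Q(ζ)} ≤ e^{r(ζ)} ≤ e^{½(2λ_w+Λ_w)Q(ζ)}` — stability (and non-degeneracy) of the factor that re-enters the road, with the
rate REGENERATED from the current second-order class, not inherited. [folklore] -/
theorem residual_factor_regulated {M : Matrix ι ι ℝ} {γop m lamw Λw : ℝ} (hM : M.PosDef)
    (hfl : ∀ z : ι → ℝ, m * ∑ i, z i ^ 2 ≤ z ⬝ᵥ (M *ᵥ z)) (hΓop : (γop • (1 : Matrix ι ι ℝ) - M⁻¹).PosSemidef)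
    (hdisj : ∀ p q, p ≠ q → Disjoint (cell p) (cell q)) (hw' : ∀ x t, HasDerivAt (w x) (w' x t) t)
    (hw'' : ∀ x t, HasDerivAt (w' x) (w'' x t) t) (hw'm : ∀ x, Measurable (w' x)) (hw''m : ∀ x, Measurable (w'' x))
    (hκ₀ : 0 ≤ κ₀) (hκ₁ : 0 ≤ κ₁) (hτ : 0 < τ) (hδ : 0 < δ) (hθ0 : 0 < θ) (hθ1 : θ < 1) (hκθ : (2 * κ₀ * (1 + τ) + 4 * δ) * γop ≤ θ)
    (hκθ₆ : 6 * κ₀ * (1 + τ) * γop ≤ θ) (hstab : ∀ x, ∀ t : ℝ, -(κ₀ * t ^ 2) ≤ w x t) (hquad : ∀ x, ∀ t : ℝ, w x t ≤ κ₀ * t ^ 2)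
    (hw'b : ∀ x t, |w' x t| ≤ κ₁ * |t|) (hw''b : ∀ x t, |w'' x t| ≤ κ₂) (hlamw : 0 ≤ lamw)
    (hwlo : ∀ u (a b : ℝ), w u a + w' u a * (b - a) - lamw / 2 * (b - a) ^ 2 ≤ w u b)
    (hwup : ∀ x (a b : ℝ), w x b ≤ w x a + w' x a * (b - a) + Λw / 2 * (b - a) ^ 2) (hm : 2 * lamw ≤ m) (C : Finset V)
    (ψ₀ ζ : EuclideanSpace ℝ ι) :
    Real.exp (Real.log (∫ ω : EuclideanSpace ℝ ι, exp (-(∑ x ∈ C.biUnion cell, w x (ω x + (ψ₀ x + ζ x)))) ∂(multivariateGaussian 0 M⁻¹)) -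
          Real.log (∫ ω : EuclideanSpace ℝ ι, exp (-(∑ x ∈ C.biUnion cell, w x (ω x + ψ₀ x))) ∂(multivariateGaussian 0 M⁻¹)) +
        ((fun x : ι => ((∫ ω : EuclideanSpace ℝ ι, exp (-(∑ p ∈ C, ∑ x ∈ cell p, w x (ω x + ψ₀ x))) ∂(multivariateGaussian 0 M⁻¹))⁻¹ •
        ∫ ω : EuclideanSpace ℝ ι, exp (-(∑ p ∈ C, ∑ x ∈ cell p, w x (ω x + ψ₀ x))) •
          (∑ p ∈ C, ∑ x ∈ cell p, (w' x (ω x + ψ₀ x)) • (EuclideanSpace.proj x : EuclideanSpace ℝ ι →L[ℝ] ℝ))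
          ∂(multivariateGaussian 0 M⁻¹)) (EuclideanSpace.single x (1 : ℝ))) ⬝ᵥ (WithLp.ofLp ζ)) +
        ((WithLp.ofLp ζ) ⬝ᵥ (Matrix.of fun x y : ι =>
      ((((∫ ω : EuclideanSpace ℝ ι, exp (-(∑ p ∈ C, ∑ x ∈ cell p, w x (ω x + ψ₀ x))) ∂(multivariateGaussian 0 M⁻¹))⁻¹ •
          (∫ ω : EuclideanSpace ℝ ι, exp (-(∑ p ∈ C, ∑ x ∈ cell p, w x (ω x + ψ₀ x))) •
            ((∑ p ∈ C, ∑ x ∈ cell p, (w'' x (ω x + ψ₀ x)) • ((EuclideanSpace.proj x : EuclideanSpace ℝ ι →L[ℝ] ℝ).smulRight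
                (EuclideanSpace.proj x : EuclideanSpace ℝ ι →L[ℝ] ℝ))) -
              (∑ p ∈ C, ∑ x ∈ cell p, (w' x (ω x + ψ₀ x)) • (EuclideanSpace.proj x : EuclideanSpace ℝ ι →L[ℝ] ℝ)).smulRight
                (∑ p ∈ C, ∑ x ∈ cell p, (w' x (ω x + ψ₀ x)) • (EuclideanSpace.proj x : EuclideanSpace ℝ ι →L[ℝ] ℝ)))
            ∂(multivariateGaussian 0 M⁻¹)) +
        (((∫ ω : EuclideanSpace ℝ ι, exp (-(∑ p ∈ C, ∑ x ∈ cell p, w x (ω x + ψ₀ x))) ∂(multivariateGaussian 0 M⁻¹)) ^ 2)⁻¹ •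
          ∫ ω : EuclideanSpace ℝ ι, exp (-(∑ p ∈ C, ∑ x ∈ cell p, w x (ω x + ψ₀ x))) •
            (∑ p ∈ C, ∑ x ∈ cell p, (w' x (ω x + ψ₀ x)) • (EuclideanSpace.proj x : EuclideanSpace ℝ ι →L[ℝ] ℝ))
            ∂(multivariateGaussian 0 M⁻¹)).smulRight
          (∫ ω : EuclideanSpace ℝ ι, exp (-(∑ p ∈ C, ∑ x ∈ cell p, w x (ω x + ψ₀ x))) •
            (∑ p ∈ C, ∑ x ∈ cell p, (w' x (ω x + ψ₀ x)) • (EuclideanSpace.proj x : EuclideanSpace ℝ ι →L[ℝ] ℝ))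
            ∂(multivariateGaussian 0 M⁻¹)))
          (EuclideanSpace.single x (1 : ℝ)) (EuclideanSpace.single y (1 : ℝ)) +
        ((∫ ω : EuclideanSpace ℝ ι, exp (-(∑ p ∈ C, ∑ x ∈ cell p, w x (ω x + ψ₀ x))) ∂(multivariateGaussian 0 M⁻¹))⁻¹ •
          (∫ ω : EuclideanSpace ℝ ι, exp (-(∑ p ∈ C, ∑ x ∈ cell p, w x (ω x + ψ₀ x))) •
            ((∑ p ∈ C, ∑ x ∈ cell p, (w'' x (ω x + ψ₀ x)) • ((EuclideanSpace.proj x : EuclideanSpace ℝ ι →L[ℝ] ℝ).smulRight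
                (EuclideanSpace.proj x : EuclideanSpace ℝ ι →L[ℝ] ℝ))) -
              (∑ p ∈ C, ∑ x ∈ cell p, (w' x (ω x + ψ₀ x)) • (EuclideanSpace.proj x : EuclideanSpace ℝ ι →L[ℝ] ℝ)).smulRight
                (∑ p ∈ C, ∑ x ∈ cell p, (w' x (ω x + ψ₀ x)) • (EuclideanSpace.proj x : EuclideanSpace ℝ ι →L[ℝ] ℝ)))
            ∂(multivariateGaussian 0 M⁻¹)) +
        (((∫ ω : EuclideanSpace ℝ ι, exp (-(∑ p ∈ C, ∑ x ∈ cell p, w x (ω x + ψ₀ x))) ∂(multivariateGaussian 0 M⁻¹)) ^ 2)⁻¹ •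
          ∫ ω : EuclideanSpace ℝ ι, exp (-(∑ p ∈ C, ∑ x ∈ cell p, w x (ω x + ψ₀ x))) •
            (∑ p ∈ C, ∑ x ∈ cell p, (w' x (ω x + ψ₀ x)) • (EuclideanSpace.proj x : EuclideanSpace ℝ ι →L[ℝ] ℝ))
            ∂(multivariateGaussian 0 M⁻¹)).smulRight
          (∫ ω : EuclideanSpace ℝ ι, exp (-(∑ p ∈ C, ∑ x ∈ cell p, w x (ω x + ψ₀ x))) •
            (∑ p ∈ C, ∑ x ∈ cell p, (w' x (ω x + ψ₀ x)) • (EuclideanSpace.proj x : EuclideanSpace ℝ ι →L[ℝ] ℝ))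
            ∂(multivariateGaussian 0 M⁻¹)))
          (EuclideanSpace.single y (1 : ℝ)) (EuclideanSpace.single x (1 : ℝ))) / 2)) *ᵥ (WithLp.ofLp ζ)) / 2) ≤
        Real.exp ((2 * lamw + Λw) * (∑ x ∈ C.biUnion cell, ζ x ^ 2) / 2) ∧
      Real.exp (-((2 * lamw + Λw) * (∑ x ∈ C.biUnion cell, ζ x ^ 2) / 2)) ≤
        Real.exp (Real.log (∫ ω : EuclideanSpace ℝ ι, exp (-(∑ x ∈ C.biUnion cell, w x (ω x + (ψ₀ x + ζ x)))) ∂(multivariateGaussian 0 M⁻¹)) -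
          Real.log (∫ ω : EuclideanSpace ℝ ι, exp (-(∑ x ∈ C.biUnion cell, w x (ω x + ψ₀ x))) ∂(multivariateGaussian 0 M⁻¹)) +
        ((fun x : ι => ((∫ ω : EuclideanSpace ℝ ι, exp (-(∑ p ∈ C, ∑ x ∈ cell p, w x (ω x + ψ₀ x))) ∂(multivariateGaussian 0 M⁻¹))⁻¹ •
        ∫ ω : EuclideanSpace ℝ ι, exp (-(∑ p ∈ C, ∑ x ∈ cell p, w x (ω x + ψ₀ x))) •
          (∑ p ∈ C, ∑ x ∈ cell p, (w' x (ω x + ψ₀ x)) • (EuclideanSpace.proj x : EuclideanSpace ℝ ι →L[ℝ] ℝ))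
          ∂(multivariateGaussian 0 M⁻¹)) (EuclideanSpace.single x (1 : ℝ))) ⬝ᵥ (WithLp.ofLp ζ)) +
        ((WithLp.ofLp ζ) ⬝ᵥ (Matrix.of fun x y : ι =>
      ((((∫ ω : EuclideanSpace ℝ ι, exp (-(∑ p ∈ C, ∑ x ∈ cell p, w x (ω x + ψ₀ x))) ∂(multivariateGaussian 0 M⁻¹))⁻¹ •
          (∫ ω : EuclideanSpace ℝ ι, exp (-(∑ p ∈ C, ∑ x ∈ cell p, w x (ω x + ψ₀ x))) •
            ((∑ p ∈ C, ∑ x ∈ cell p, (w'' x (ω x + ψ₀ x)) • ((EuclideanSpace.proj x : EuclideanSpace ℝ ι →L[ℝ] ℝ).smulRight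
                (EuclideanSpace.proj x : EuclideanSpace ℝ ι →L[ℝ] ℝ))) -
              (∑ p ∈ C, ∑ x ∈ cell p, (w' x (ω x + ψ₀ x)) • (EuclideanSpace.proj x : EuclideanSpace ℝ ι →L[ℝ] ℝ)).smulRight
                (∑ p ∈ C, ∑ x ∈ cell p, (w' x (ω x + ψ₀ x)) • (EuclideanSpace.proj x : EuclideanSpace ℝ ι →L[ℝ] ℝ)))
            ∂(multivariateGaussian 0 M⁻¹)) +
        (((∫ ω : EuclideanSpace ℝ ι, exp (-(∑ p ∈ C, ∑ x ∈ cell p, w x (ω x + ψ₀ x))) ∂(multivariateGaussian 0 M⁻¹)) ^ 2)⁻¹ •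
          ∫ ω : EuclideanSpace ℝ ι, exp (-(∑ p ∈ C, ∑ x ∈ cell p, w x (ω x + ψ₀ x))) •
            (∑ p ∈ C, ∑ x ∈ cell p, (w' x (ω x + ψ₀ x)) • (EuclideanSpace.proj x : EuclideanSpace ℝ ι →L[ℝ] ℝ))
            ∂(multivariateGaussian 0 M⁻¹)).smulRight
          (∫ ω : EuclideanSpace ℝ ι, exp (-(∑ p ∈ C, ∑ x ∈ cell p, w x (ω x + ψ₀ x))) •
            (∑ p ∈ C, ∑ x ∈ cell p, (w' x (ω x + ψ₀ x)) • (EuclideanSpace.proj x : EuclideanSpace ℝ ι →L[ℝ] ℝ))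
            ∂(multivariateGaussian 0 M⁻¹)))
          (EuclideanSpace.single x (1 : ℝ)) (EuclideanSpace.single y (1 : ℝ)) +
        ((∫ ω : EuclideanSpace ℝ ι, exp (-(∑ p ∈ C, ∑ x ∈ cell p, w x (ω x + ψ₀ x))) ∂(multivariateGaussian 0 M⁻¹))⁻¹ •
          (∫ ω : EuclideanSpace ℝ ι, exp (-(∑ p ∈ C, ∑ x ∈ cell p, w x (ω x + ψ₀ x))) •
            ((∑ p ∈ C, ∑ x ∈ cell p, (w'' x (ω x + ψ₀ x)) • ((EuclideanSpace.proj x : EuclideanSpace ℝ ι →L[ℝ] ℝ).smulRight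
                (EuclideanSpace.proj x : EuclideanSpace ℝ ι →L[ℝ] ℝ))) -
              (∑ p ∈ C, ∑ x ∈ cell p, (w' x (ω x + ψ₀ x)) • (EuclideanSpace.proj x : EuclideanSpace ℝ ι →L[ℝ] ℝ)).smulRight
                (∑ p ∈ C, ∑ x ∈ cell p, (w' x (ω x + ψ₀ x)) • (EuclideanSpace.proj x : EuclideanSpace ℝ ι →L[ℝ] ℝ)))
            ∂(multivariateGaussian 0 M⁻¹)) +
        (((∫ ω : EuclideanSpace ℝ ι, exp (-(∑ p ∈ C, ∑ x ∈ cell p, w x (ω x + ψ₀ x))) ∂(multivariateGaussian 0 M⁻¹)) ^ 2)⁻¹ •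
          ∫ ω : EuclideanSpace ℝ ι, exp (-(∑ p ∈ C, ∑ x ∈ cell p, w x (ω x + ψ₀ x))) •
            (∑ p ∈ C, ∑ x ∈ cell p, (w' x (ω x + ψ₀ x)) • (EuclideanSpace.proj x : EuclideanSpace ℝ ι →L[ℝ] ℝ))
            ∂(multivariateGaussian 0 M⁻¹)).smulRight
          (∫ ω : EuclideanSpace ℝ ι, exp (-(∑ p ∈ C, ∑ x ∈ cell p, w x (ω x + ψ₀ x))) •
            (∑ p ∈ C, ∑ x ∈ cell p, (w' x (ω x + ψ₀ x)) • (EuclideanSpace.proj x : EuclideanSpace ℝ ι →L[ℝ] ℝ))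
            ∂(multivariateGaussian 0 M⁻¹)))
          (EuclideanSpace.single y (1 : ℝ)) (EuclideanSpace.single x (1 : ℝ))) / 2)) *ᵥ (WithLp.ofLp ζ)) / 2) := by
  have h := residual_global_letter hM hfl hΓop hdisj hw' hw'' hw'm hw''m hκ₀ hκ₁ hτ hδ hθ0 hθ1 hκθ hκθ₆ hstab hquad hw'b hw''b hlamw hwlo
    hwup hm C ψ₀ ζ
  rw [abs_le] at h
  constructor
  · exact Real.exp_le_exp.2 (by linarith [h.2])
  · exact Real.exp_le_exp.2 (by linarith [h.1])

end Road

/-! ## §3. Toy -/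

/-- Toy (§2's arithmetic): `|r| ≤ (λ + Λ∕2)Q` is `|r| ≤ (2λ+Λ)Q∕2`. -/
example (r lam Λ Q : ℝ) (h : |r| ≤ (lam + Λ / 2) * Q) : |r| ≤ (2 * lam + Λ) * Q / 2 := by linarith

end Summit.QuantumFields.BalabanUV.T4Continuum.NE7b.SupResidualFactorRegulated
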